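import Mathlib.NumberTheory.ModularForms.EisensteinSeries.Basic
import Mathlib.NumberTheory.ModularForms.CongruenceSubgroups
import HarnessLib

/-!
# The Eisenstein series `G_k^v(τ) = ∑_{x ≡ v (N)} (x₀τ + x₁)^{-k}` of level `Γ(N)` summed over a
# full congruence class (Diamond–Shurman §4.2)

Topic `Literature/NumberTheory/ModularForms`.  For `N ≥ 1`, `k ≥ 3` and a class
`v ∈ (ℤ/Nℤ)²`, Diamond–Shurman (*A First Course in Modular Forms*, §4.2, (4.4)) define

  `G_k^v(τ) = ∑' _{(c,d) ≡ v (mod N)} (cτ + d)^{-k}`,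

the sum over ALL lattice vectors in the class `v + Nℤ²` (the primed sum omits `(0,0)`, which only
occurs for `v = 0` and contributes `0^{-k} = 0` in Lean).  Mathlib's `eisensteinSeries a k`
(`ModularForm.eisensteinSeriesMF`) is the sub-sum over the vectors with `gcd(c, d) = 1`
(Diamond–Shurman's `E_k^v`, (4.5)); the two families span the same space but only `G_k^v` has an
elementary Fourier expansion (Diamond–Shurman Thm. 4.2.3), which is why we need it: it is the
explicit `SL₂(ℤ)`-equivariant family with cyclotomic Fourier coefficients behind the `q`-expansion
principle at all cusps (`SturmCongruenceProofs.lean`, hypothesis `hX`).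

This file (definitions + the modular-form structure, copied from Mathlib's treatment of
`eisensteinSeries` with the index set `gammaSet N 1 a` replaced by the full class):

* `latticeCoset N a` — the class `{x : ℤ² | x ≡ a (mod N)}`; `latticeCosetEquiv` — its
  permutation by `γ ∈ SL₂(ℤ)` (`x ↦ xγ` maps the class of `a` onto the class of `aγ`);
* `latticeEisenstein N k a τ = ∑' x ∈ latticeCoset N a, (x₀ τ + x₁)^{-k}` (Mathlib `eisSummand`);
* `latticeEisenstein_slash` — **`G_k^a ∣_k γ = G_k^{aγ}`** for every `γ ∈ SL₂(ℤ)`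
  (Diamond–Shurman (4.6)/Prop. 4.2.1); `latticeEisensteinSIF` — invariance under `Γ(N)`;
* `latticeEisenstein_tendstoLocallyUniformly`, `mdifferentiable_latticeEisensteinSIF`,
  `isBoundedAtImInfty_latticeEisensteinSIF_slash` — absolute and locally uniform convergence for
  `k ≥ 3`, holomorphy, boundedness at all cusps (Mathlib's bounds `summand_bound`,
  `summable_one_div_norm_rpow`);
* `latticeEisensteinMF N k a : ModularForm (Gamma N) k` (`3 ≤ k`) and
  `latticeEisensteinMF_slash` — the translates of `G_k^a` are the `G_k^{aγ}`.

The Fourier expansion is in the sequel `EisensteinLatticeCosetRows.lean`.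

## References

* [DiamondShurman2005] F. Diamond, J. Shurman, *A First Course in Modular Forms*, GTM 228
  (2005), §4.2: (4.4) `G_k^v`, Prop. 4.2.1, Thm. 4.2.3.
-/

noncomputable section

namespace Literature.NumberTheory.ModularForms

open scoped MatrixGroups ModularForm Manifold
open UpperHalfPlane ModularForm EisensteinSeries CongruenceSubgroup Matrix
  Matrix.SpecialLinearGroup Filter Complex SlashInvariantForm

/-! ### The congruence class and its permutation by `SL₂(ℤ)` -/

section Coset

variable (N : ℕ) (a : Fin 2 → ZMod N)

/-- The congruence class `{x ∈ ℤ² | x ≡ a (mod N)}` of `a ∈ (ℤ/Nℤ)²` (the index set of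
Diamond–Shurman's `G_k^a`, §4.2 (4.4); Mathlib's `gammaSet N r a` is its subset of vectors of
gcd `r`). [cite: DiamondShurman2005, §4.2 (4.4)] -/
def latticeCoset : Set (Fin 2 → ℤ) := {x | ((↑) : ℤ → ZMod N) ∘ x = a}

variable {N a}

/-- Membership in the class. [folklore] -/
@[simp] theorem mem_latticeCoset {x : Fin 2 → ℤ} :
    x ∈ latticeCoset N a ↔ ((↑) : ℤ → ZMod N) ∘ x = a := Iff.rfl

/-- Right multiplication by `γ ∈ SL₂(ℤ)` maps the class of `a` into the class of `aγ`.
[folklore] -/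
theorem vecMul_mem_latticeCoset {x : Fin 2 → ℤ} (hx : x ∈ latticeCoset N a) (γ : SL(2, ℤ)) :
    x ᵥ* (γ : Matrix (Fin 2) (Fin 2) ℤ) ∈ latticeCoset N (a ᵥ* γ) := by
  have := RingHom.map_vecMul (m := Fin 2) (n := Fin 2) (Int.castRingHom (ZMod N)) γ x
  simp only [eq_intCast, Int.coe_castRingHom] at this
  rw [mem_latticeCoset] at hx ⊢
  simp_rw [Function.comp_def, this, ← hx]
  simp [Function.comp_def]

variable (a) in
/-- The bijection `x ↦ xγ` between the classes of `a` and of `aγ`. [folklore] -/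
def latticeCosetEquiv (γ : SL(2, ℤ)) :
    latticeCoset N a ≃ latticeCoset N (a ᵥ* γ) where
  toFun x := ⟨x.1 ᵥ* (γ : Matrix (Fin 2) (Fin 2) ℤ), vecMul_mem_latticeCoset x.2 γ⟩
  invFun x := ⟨x.1 ᵥ* ((γ⁻¹ : SL(2, ℤ)) : Matrix (Fin 2) (Fin 2) ℤ), by
      have h := vecMul_mem_latticeCoset x.2 γ⁻¹
      have hγ : (a ᵥ* γ) ᵥ* ((γ⁻¹ : SL(2, ℤ)) : Matrix (Fin 2) (Fin 2) (ZMod N)) = a := by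
        rw [vecMul_vecMul, ← Matrix.SpecialLinearGroup.coe_mul, ← map_mul, mul_inv_cancel, map_one,
          Matrix.SpecialLinearGroup.coe_one, vecMul_one]
      rwa [hγ] at h⟩
  left_inv x := Subtype.ext <| by
    show (x.1 ᵥ* (γ : Matrix (Fin 2) (Fin 2) ℤ)) ᵥ* ((γ⁻¹ : SL(2, ℤ)) : Matrix (Fin 2) (Fin 2) ℤ) = x.1
    rw [vecMul_vecMul, ← Matrix.SpecialLinearGroup.coe_mul, mul_inv_cancel,
      Matrix.SpecialLinearGroup.coe_one, vecMul_one]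
  right_inv x := Subtype.ext <| by
    show (x.1 ᵥ* ((γ⁻¹ : SL(2, ℤ)) : Matrix (Fin 2) (Fin 2) ℤ)) ᵥ* (γ : Matrix (Fin 2) (Fin 2) ℤ) = x.1
    rw [vecMul_vecMul, ← Matrix.SpecialLinearGroup.coe_mul, inv_mul_cancel,
      Matrix.SpecialLinearGroup.coe_one, vecMul_one]

end Coset

/-! ### The series, its slash-equivariance and invariance under `Γ(N)` -/

section Series

variable (N : ℕ) (k : ℤ) (a : Fin 2 → ZMod N)

/-- **The Eisenstein series `G_k^a` of level `Γ(N)` over a full congruence class**: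
`G_k^a(τ) = ∑_{x ∈ ℤ², x ≡ a (N)} (x₀ τ + x₁)^{-k}` (Diamond–Shurman §4.2 (4.4); the term
`x = 0`, present only when `a = 0`, is `0^{-k} = 0`).  Absolutely convergent for `k ≥ 3`.
[cite: DiamondShurman2005, §4.2 (4.4)] -/
def latticeEisenstein (τ : ℍ) : ℂ := ∑' x : latticeCoset N a, eisSummand k x τ

variable {N a}

/-- **Equivariance: `G_k^a ∣_k γ = G_k^{aγ}`** for `γ ∈ SL₂(ℤ)` (Diamond–Shurman Prop. 4.2.1 /
(4.6)); reindex the class by `x ↦ xγ`. [cite: DiamondShurman2005, Prop. 4.2.1] -/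
theorem latticeEisenstein_slash (γ : SL(2, ℤ)) :
    latticeEisenstein N k a ∣[k] γ = latticeEisenstein N k (a ᵥ* γ) := by
  ext1 z
  simp_rw [SL_slash_apply, zpow_neg,
    mul_inv_eq_iff_eq_mul₀ (zpow_ne_zero _ <| denom_ne_zero _ z),
    latticeEisenstein, eisSummand_SL2_apply, tsum_mul_left, mul_comm (_ ^ k)]
  congr 1
  exact (latticeCosetEquiv a γ).tsum_eq (eisSummand k · z)

variable (N a) in
/-- `G_k^a` as a slash-invariant form of level `Γ(N)` (`aγ = a` for `γ ≡ 1 (N)`). [folklore] -/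
def latticeEisensteinSIF : SlashInvariantForm (Gamma N) k where
  toFun := latticeEisenstein N k a
  slash_action_eq' A hA := by
    obtain ⟨A, (hA : A ∈ Gamma N), rfl⟩ := hA
    simp [SpecialLinearGroup.mapGL, ← SL_slash, latticeEisenstein_slash, Gamma_mem'.mp hA]

/-- Unfolding lemma. [folklore] -/
@[simp] theorem latticeEisensteinSIF_apply (z : ℍ) :
    latticeEisensteinSIF N k a z = latticeEisenstein N k a z := rfl

/-- Unfolding lemma for the coercion to a function. [folklore] -/
theorem coe_latticeEisensteinSIF :
    (⇑(latticeEisensteinSIF N k a) : ℍ → ℂ) = latticeEisenstein N k a := rfl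

end Series

/-! ### Convergence, holomorphy and boundedness for `k ≥ 3` -/

section Analysis

variable {N : ℕ} {k : ℤ} (a : Fin 2 → ZMod N)

/-- Absolute convergence: the class is a subset of `ℤ²`, on which Mathlib's
`summable_norm_eisSummand` holds for `k ≥ 3`. [folklore] -/
theorem summable_norm_eisSummand_latticeCoset (hk : 3 ≤ k) (z : ℍ) :
    Summable fun x : latticeCoset N a ↦ ‖eisSummand k x z‖ :=
  (summable_norm_eisSummand hk z).subtype _

/-- Locally uniform convergence of the partial sums of `G_k^a` on `ℍ` (`k ≥ 3`), as for Mathlib's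
`eisensteinSeries_tendstoLocallyUniformly`. [folklore] -/
theorem latticeEisenstein_tendstoLocallyUniformly (hk : 3 ≤ k) :
    TendstoLocallyUniformly (fun (s : Finset (latticeCoset N a)) ↦ (∑ x ∈ s, eisSummand k x ·))
      (latticeEisenstein N k a ·) Filter.atTop := by
  have hk' : (2 : ℝ) < k := by norm_cast
  have p_sum : Summable fun x : latticeCoset N a ↦ ‖x.val‖ ^ (-k) :=
    mod_cast (summable_one_div_norm_rpow hk').subtype (latticeCoset N a)
  simp only [tendstoLocallyUniformly_iff_forall_isCompact, latticeEisenstein]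
  intro K hK
  obtain ⟨A, B, hB, HABK⟩ := subset_verticalStrip_of_isCompact hK
  refine (tendstoUniformlyOn_tsum (hu := p_sum.mul_left <| r ⟨⟨A, B⟩, hB⟩ ^ (-k : ℝ))
    (fun p z hz ↦ ?_)).mono HABK
  simpa only [eisSummand, one_div, ← zpow_neg, norm_zpow, ← Real.rpow_intCast,
    Int.cast_neg] using summand_bound_of_mem_verticalStrip (by positivity) p hB hz

/-- The same, for the extensions by zero to `ℂ`. [folklore] -/
theorem latticeEisenstein_tendstoLocallyUniformlyOn (hk : 3 ≤ k) :
    TendstoLocallyUniformlyOn (fun (s : Finset (latticeCoset N a)) ↦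
      ↑ₕ(fun (z : ℍ) ↦ ∑ x ∈ s, eisSummand k x z)) (↑ₕ(latticeEisensteinSIF N k a))
        Filter.atTop {z : ℂ | 0 < z.im} := by
  rw [← upperHalfPlaneSet, ← range_coe, ← Set.image_univ]
  apply TendstoLocallyUniformlyOn.comp (s := ⊤) _ _ _ (OpenPartialHomeomorph.continuousOn_symm _)
  · simp only [Set.top_eq_univ, tendstoLocallyUniformlyOn_univ]
    exact latticeEisenstein_tendstoLocallyUniformly a hk
  · simp only [Topology.IsOpenEmbedding.toOpenPartialHomeomorph_target, Set.top_eq_univ,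
      Set.mapsTo_range_iff, Set.mem_univ, forall_const]

/-- **Holomorphy of `G_k^a`** (`k ≥ 3`). [folklore] -/
theorem mdifferentiable_latticeEisensteinSIF (hk : 3 ≤ k) :
    MDiff (latticeEisensteinSIF N k a) := by
  intro τ
  suffices DifferentiableAt ℂ (↑ₕ(latticeEisensteinSIF N k a)) τ.1 by
    convert!
      MDifferentiableAt.comp τ (DifferentiableAt.mdifferentiableAt this) τ.mdifferentiable_coe
    exact funext fun z ↦ (comp_ofComplex (latticeEisensteinSIF N k a) z).symm
  refine DifferentiableOn.differentiableAt ?_ (isOpen_upperHalfPlaneSet.mem_nhds τ.2)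
  exact (latticeEisenstein_tendstoLocallyUniformlyOn a hk).differentiableOn
    (Eventually.of_forall fun s ↦ DifferentiableOn.fun_sum
    fun _ _ ↦ eisSummand_extension_differentiableOn _ _) isOpen_upperHalfPlaneSet

/-- The norm of `G_k^a(z)` is at most the full sum of norms over `ℤ²`. [folklore] -/
theorem norm_latticeEisenstein_le_tsum_norm (hk : 3 ≤ k) (z : ℍ) :
    ‖latticeEisenstein N k a z‖ ≤ ∑' x : Fin 2 → ℤ, ‖eisSummand k x z‖ := by
  rw [latticeEisenstein]
  exact le_trans (norm_tsum_le_tsum_norm ((summable_norm_eisSummand hk z).subtype _))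
    (Summable.tsum_subtype_le (fun x : Fin 2 → ℤ ↦ ‖eisSummand k x z‖) _ (fun _ ↦ norm_nonneg _)
      (summable_norm_eisSummand hk z))

/-- **Boundedness at all cusps**: every `SL₂(ℤ)`-translate of `G_k^a` is bounded at `i∞`
(`k ≥ 3`, `N ≥ 1`), as for Mathlib's `isBoundedAtImInfty_eisensteinSeriesSIF`. [folklore] -/
theorem isBoundedAtImInfty_latticeEisensteinSIF_slash [NeZero N] (hk : 3 ≤ k) (A : SL(2, ℤ)) :
    IsBoundedAtImInfty ((⇑(latticeEisensteinSIF N k a)) ∣[k] A) := by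
  simp_rw [UpperHalfPlane.isBoundedAtImInfty_iff, coe_latticeEisensteinSIF] at *
  refine ⟨∑' x : Fin 2 → ℤ, r ⟨⟨N, 2⟩, Nat.ofNat_pos⟩ ^ (-k) * ‖x‖ ^ (-k), 2, ?_⟩
  intro z hz
  obtain ⟨n, hn⟩ := ModularGroup_T_zpow_mem_verticalStrip z (NeZero.pos N)
  rw [latticeEisenstein_slash, ← latticeEisensteinSIF_apply,
    ← T_zpow_width_invariant N k n (latticeEisensteinSIF N k (a ᵥ* A)) z, latticeEisensteinSIF_apply]
  apply le_trans (norm_latticeEisenstein_le_tsum_norm _ hk _)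
  have hk' : (2 : ℝ) < k := by norm_cast
  apply (summable_norm_eisSummand hk _).tsum_le_tsum _
  · exact_mod_cast (summable_one_div_norm_rpow hk').mul_left <| r ⟨⟨N, 2⟩, Nat.ofNat_pos⟩ ^ (-k)
  · intro x
    simp_rw [eisSummand, norm_zpow]
    exact_mod_cast
      summand_bound_of_mem_verticalStrip (lt_trans two_pos hk').le x two_pos
      (verticalStrip_anti_right N hz hn)

end Analysis

/-! ### The modular form -/

section ModularForm

variable (N : ℕ) [NeZero N] {k : ℤ} (hk : 3 ≤ k) (a : Fin 2 → ZMod N)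

/-- **`G_k^a` is a modular form of weight `k` and level `Γ(N)`** for `k ≥ 3`
(Diamond–Shurman §4.2, Prop. 4.2.1 and the discussion after (4.4)). [cite: DiamondShurman2005, Prop. 4.2.1] -/
def latticeEisensteinMF : ModularForm (Gamma N) k where
  toFun := latticeEisensteinSIF N k a
  slash_action_eq' := (latticeEisensteinSIF N k a).slash_action_eq'
  holo' := mdifferentiable_latticeEisensteinSIF a hk
  bdd_at_cusps' {c} hc := by
    rw [Subgroup.IsArithmetic.isCusp_iff_isCusp_SL2Z] at hc
    rw [OnePoint.isBoundedAt_iff_forall_SL2Z hc]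
    exact fun γ _ ↦ isBoundedAtImInfty_latticeEisensteinSIF_slash a hk γ

variable {N hk a}

/-- Unfolding lemma. [folklore] -/
@[simp] theorem latticeEisensteinMF_apply (z : ℍ) :
    latticeEisensteinMF N hk a z = latticeEisenstein N k a z := rfl

/-- Unfolding lemma for the coercion. [folklore] -/
theorem coe_latticeEisensteinMF :
    (⇑(latticeEisensteinMF N hk a) : ℍ → ℂ) = latticeEisenstein N k a := rfl

/-- **The translates of `G_k^a` are the `G_k^{aγ}`**: `G_k^a ∣_k γ = G_k^{aγ}` as functions,
for every `γ ∈ SL₂(ℤ)`. [cite: DiamondShurman2005, Prop. 4.2.1] -/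
theorem latticeEisensteinMF_slash (γ : SL(2, ℤ)) :
    (⇑(latticeEisensteinMF N hk a)) ∣[k] γ =
      ⇑(latticeEisensteinMF N hk (a ᵥ* γ)) := by
  rw [coe_latticeEisensteinMF, coe_latticeEisensteinMF, latticeEisenstein_slash]

end ModularForm

end Literature.NumberTheory.ModularForms

end
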